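import Mathlib.NumberTheory.SiegelsLemma
import Mathlib.RingTheory.PowerSeries.Order
import Literature.NumberTheory.EllipticCurves.TateSeriesGrowth
import Literature.NumberTheory.Transcendental.MahlerManinXJProofs
import HarnessLib

/-!
# The Mahler–Manin theorem, first step: the auxiliary function (Siegel's lemma)

Everything in this file is **proved**; there are no new definitions.  This is the first step of
the proof of the Mahler–Manin conjecture after Barré-Sirieix–Diaz–Gramain–Philibert (1996), in the
version with the "naïve denominator" `X·J(X)` (Nesterenko–Philippon LNM 1752, Ch. 2, §2.5,
first step, and §2.1 for the denominator): for a parameter `T ≥ 1` put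

  `L₁ = 2T⁶`, `L₂ = T⁴`, `N = T¹⁰` (so `L₁ L₂ = 2N`), `Λ_T = [0, L₁) × [0, L₂)`,

and for integers `a = (a_λ)_{λ ∈ Λ_T}` consider the integer formal power series

  `F_a = Σ_{λ ∈ Λ_T} a_λ X^{λ₁} (X·J(X))^{λ₂} ∈ ℤ⟦X⟧`   (`X·J(X) = formalXJ`).

* `coeff_auxSeries` — its coefficients `bₙ = Σ_λ a_λ c_{λ₂}(n − λ₁)`, `c_k(m) = coeff_m((XJ)ᵏ)`;
* `exists_siegel_coeffs` — **Siegel's lemma** (Mathlib's `Int.Matrix.exists_ne_zero_int_vec_norm_le`,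
  `N` equations, `2N` unknowns, exponent `N/(2N − N) = 1`) with the growth bound
  `0 ≤ c_k(m) ≤ exp(56√(km) + 27k)` (`TateSeriesGrowth.lean`): there is `a ≠ 0` supported in `Λ_T`
  with `|a_λ| ≤ 2T¹⁰ exp(56T⁷ + 27T⁴)` and `bₙ = 0` for `n < N`;
* `auxSeries_ne_zero` — `F_a ≠ 0` for `a ≠ 0` (algebraic independence of `X` and `X·J(X)`,
  `FormalXJTranscendental_holds`, i.e. BDGP Lemme 4);
* `abs_coeff_auxSeries_le` — `|bₙ| ≤ L(a) exp(56 T² √n + 27 T⁴)`, `L(a) = Σ |a_λ|`;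
* `exists_order_of_ne_zero` — the order `M ≥ N` of vanishing of `F_a` at `0`, `b_M ≠ 0`.

## References

* [BarreSirieixDiazGramainPhilibert1996Manin] K. Barré-Sirieix, G. Diaz, F. Gramain,
  G. Philibert, Invent. Math. 124 (1996) 1–9, §2 (first step) and Lemme 4.
* [NesterenkoPhilippon2001] LNM 1752, Ch. 2 (G. Diaz), §2.5, proof of Thm. 2.11, first step;
  Lemma 2.6 (Siegel's lemma).
-/

noncomputable section

open Finset PowerSeries Real Literature.NumberTheory.EllipticCurves

namespace Literature.NumberTheory.Transcendental

/-! Throughout, `Λ_T` is the finset `range (2 T⁶) ×ˢ range (T⁴)` and the auxiliary series is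
`F_a = ∑ l ∈ Λ_T, C (a l) * X ^ l.1 * formalXJ ^ l.2 ∈ ℤ⟦X⟧` (written out in full; this file
declares no notation). -/

/-! ### Coefficients of the auxiliary series -/

/-- The coefficients of `F_a`: `bₙ = Σ_{λ ∈ Λ_T, λ₁ ≤ n} a_λ · coeff_{n-λ₁}((XJ)^{λ₂})`
(Nesterenko–Philippon Ch. 2 §2.5, first step, formula for `bₙ`). [cite: NesterenkoPhilippon2001, Ch. 2, §2.5] -/
theorem coeff_auxSeries (a : ℕ × ℕ → ℤ) (T n : ℕ) :
    coeff n (∑ l ∈ range (2 * T ^ 6) ×ˢ range (T ^ 4), PowerSeries.C (a l) * X ^ l.1 * formalXJ ^ l.2) =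
      ∑ l ∈ (range (2 * T ^ 6) ×ˢ range (T ^ 4)), a l * (if l.1 ≤ n then coeff (n - l.1) (formalXJ ^ l.2) else 0) := by
  rw [map_sum]
  refine sum_congr rfl fun l _ ↦ ?_
  rw [mul_assoc, coeff_C_mul, coeff_X_pow_mul']

/-- `|bₙ| ≤ L(a) · exp(56 T² √n + 27 T⁴)` with `L(a) = Σ_λ |a_λ|`, from
`0 ≤ c_k(m) ≤ exp(56 √(km) + 27 k)` and `k < T⁴`, `m ≤ n`. [folklore] -/
theorem abs_coeff_auxSeries_le (a : ℕ × ℕ → ℤ) (T n : ℕ) :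
    |((coeff n (∑ l ∈ range (2 * T ^ 6) ×ˢ range (T ^ 4), PowerSeries.C (a l) * X ^ l.1 * formalXJ ^ l.2) : ℤ) : ℝ)| ≤
      (∑ l ∈ (range (2 * T ^ 6) ×ˢ range (T ^ 4)), |(a l : ℝ)|) * Real.exp (56 * T ^ 2 * Real.sqrt n + 27 * T ^ 4) := by
  rw [coeff_auxSeries, Int.cast_sum, sum_mul]
  refine (abs_sum_le_sum_abs _ _).trans (sum_le_sum fun l hl ↦ ?_)
  rw [Int.cast_mul, abs_mul]
  refine mul_le_mul_of_nonneg_left ?_ (abs_nonneg _)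
  obtain ⟨h1, h2⟩ := mem_product.mp hl
  rw [mem_range] at h1 h2
  split_ifs with h
  · rw [← Int.cast_abs, abs_of_nonneg (coeff_formalXJ_pow_nonneg _ _)]
    refine (coeff_formalXJ_pow_le_exp l.2 (n - l.1)).trans ?_
    rw [Real.exp_le_exp]
    have hl2 : (l.2 : ℝ) ≤ T ^ 4 := by exact_mod_cast h2.le
    have hsqrt : Real.sqrt ((l.2 : ℕ) * ((n - l.1 : ℕ) : ℕ)) ≤ T ^ 2 * Real.sqrt n := by
      rw [show (T : ℝ) ^ 2 = Real.sqrt ((T : ℝ) ^ 4) by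
        rw [show (T : ℝ) ^ 4 = ((T : ℝ) ^ 2) ^ 2 by ring, Real.sqrt_sq (by positivity)],
        ← Real.sqrt_mul (by positivity)]
      refine Real.sqrt_le_sqrt (mul_le_mul hl2 ?_ (by positivity) (by positivity))
      exact_mod_cast Nat.sub_le n l.1
    nlinarith [hsqrt, hl2, Real.sqrt_nonneg (n : ℝ)]
  · simp only [Int.cast_zero, abs_zero]
    positivity

/-! ### Siegel's lemma -/

/-- **First step: the auxiliary function** (Siegel's lemma).  For `T ≥ 1` there are integers
`a_λ`, `λ ∈ Λ_T = [0, 2T⁶) × [0, T⁴)`, not all zero, with `|a_λ| ≤ 2T¹⁰ · exp(56 T⁷ + 27 T⁴)`, such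
that `F_a = Σ a_λ X^{λ₁}(XJ)^{λ₂}` vanishes to order `≥ N = T¹⁰` at `0` (`N` equations in
`L₁L₂ = 2N` unknowns with coefficients `≤ exp(56 T⁷ + 27 T⁴)`; Nesterenko–Philippon Ch. 2 §2.5
first step, condition (C1) `L₁L₂ ≥ 2N`). [cite: NesterenkoPhilippon2001, Ch. 2, §2.5] -/
theorem exists_siegel_coeffs (T : ℕ) (hT : 1 ≤ T) :
    ∃ a : ℕ × ℕ → ℤ, (∀ l, l ∉ (range (2 * T ^ 6) ×ˢ range (T ^ 4)) → a l = 0) ∧ a ≠ 0 ∧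
      (∀ l, |(a l : ℝ)| ≤ 2 * T ^ 10 * Real.exp (56 * T ^ 7 + 27 * T ^ 4)) ∧
      ∀ n < T ^ 10, coeff n (∑ l ∈ range (2 * T ^ 6) ×ˢ range (T ^ 4), PowerSeries.C (a l) * X ^ l.1 * formalXJ ^ l.2) = 0 := by
  classical
  -- the matrix of the linear system `bₙ = 0`, `n < N`
  set A : Matrix (Fin (T ^ 10)) (range (2 * T ^ 6) ×ˢ range (T ^ 4)) ℤ := Matrix.of fun n l ↦
    if l.1.1 ≤ (n : ℕ) then coeff ((n : ℕ) - l.1.1) (formalXJ ^ l.1.2) else 0 with hA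
  have hT10 : 1 ≤ T ^ 10 := Nat.one_le_pow 10 T hT
  have hcardΛ : Fintype.card (range (2 * T ^ 6) ×ˢ range (T ^ 4)) = 2 * T ^ 10 := by
    rw [Fintype.card_coe, card_product, card_range, card_range]; ring
  have hcard : Fintype.card (Fin (T ^ 10)) < Fintype.card (range (2 * T ^ 6) ×ˢ range (T ^ 4)) := by
    rw [Fintype.card_fin, hcardΛ]; omega
  have hpos : 0 < Fintype.card (Fin (T ^ 10)) := by rw [Fintype.card_fin]; omega
  obtain ⟨t, ht0, hAt, htnorm⟩ := Int.Matrix.exists_ne_zero_int_vec_norm_le A hcard hpos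
  -- the entries of `A` are bounded by `exp(56 T⁷ + 27 T⁴)`
  have hAnorm := (Matrix.norm_le_iff (r := Real.exp (56 * T ^ 7 + 27 * T ^ 4)) (by positivity)
    (A := A)).mpr fun n l ↦ by
    rw [hA, Matrix.of_apply]
    obtain ⟨h1, h2⟩ := mem_product.mp l.2
    rw [mem_range] at h1 h2
    split_ifs with h
    · rw [Int.norm_eq_abs, ← Int.cast_abs, abs_of_nonneg (coeff_formalXJ_pow_nonneg _ _)]
      refine (coeff_formalXJ_pow_le_exp l.1.2 ((n : ℕ) - l.1.1)).trans ?_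
      rw [Real.exp_le_exp]
      have hl2 : (l.1.2 : ℝ) ≤ T ^ 4 := by exact_mod_cast h2.le
      have hm : (((n : ℕ) - l.1.1 : ℕ) : ℝ) ≤ T ^ 10 := by
        have := n.2
        exact_mod_cast ((Nat.sub_le _ _).trans this.le)
      have hsqrt : Real.sqrt ((l.1.2 : ℕ) * (((n : ℕ) - l.1.1 : ℕ) : ℕ)) ≤ T ^ 7 := by
        rw [show (T : ℝ) ^ 7 = Real.sqrt (((T : ℝ) ^ 7) ^ 2) by rw [Real.sqrt_sq (by positivity)]]
        refine Real.sqrt_le_sqrt ?_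
        calc ((l.1.2 : ℕ) : ℝ) * (((n : ℕ) - l.1.1 : ℕ) : ℕ) ≤ T ^ 4 * T ^ 10 :=
              mul_le_mul hl2 hm (by positivity) (by positivity)
          _ = ((T : ℝ) ^ 7) ^ 2 := by ring
      nlinarith [hsqrt, hl2]
    · rw [norm_zero]
      positivity
  -- the exponent `N/(2N - N) = 1`
  have hexp : ((Fintype.card (Fin (T ^ 10)) : ℝ) /
      (Fintype.card (range (2 * T ^ 6) ×ˢ range (T ^ 4)) - Fintype.card (Fin (T ^ 10)))) = 1 := by
    rw [Fintype.card_fin, hcardΛ]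
    have : (T : ℝ) ^ 10 ≠ 0 := by positivity
    push_cast
    field_simp
    ring
  rw [hexp, Real.rpow_one, hcardΛ] at htnorm
  -- the coefficient vector
  refine ⟨fun l ↦ if h : l ∈ (range (2 * T ^ 6) ×ˢ range (T ^ 4)) then t ⟨l, h⟩ else 0, fun l hl ↦ dif_neg hl, ?_, ?_, ?_⟩
  · -- `a ≠ 0`
    intro ha
    apply ht0
    funext l
    have := congr_fun ha l.1
    simpa only [l.2, dif_pos, Pi.zero_apply, Subtype.coe_eta] using this
  · -- the bound `|a_λ| ≤ 2T¹⁰ exp(56T⁷ + 27T⁴)`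
    intro l
    show |(((if h : l ∈ (range (2 * T ^ 6) ×ˢ range (T ^ 4)) then t ⟨l, h⟩ else 0 : ℤ) : ℝ))| ≤ _
    split_ifs with h
    · have h1 : ‖t ⟨l, h⟩‖ ≤ ‖t‖ := norm_le_pi_norm t ⟨l, h⟩
      rw [Int.norm_eq_abs] at h1
      refine h1.trans (htnorm.trans ?_)
      push_cast
      gcongr
      exact max_le (Real.one_le_exp (by positivity)) hAnorm
    · simp only [Int.cast_zero, abs_zero]
      positivity
  · -- the linear system
    intro n hn
    have h := congr_fun hAt ⟨n, hn⟩
    rw [Pi.zero_apply, Matrix.mulVec, dotProduct] at h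
    rw [coeff_auxSeries, ← sum_coe_sort (range (2 * T ^ 6) ×ˢ range (T ^ 4))]
    refine Eq.trans (sum_congr rfl fun l _ ↦ ?_) h
    rw [dif_pos l.2, hA, Matrix.of_apply, mul_comm]

/-! ### The auxiliary series is not zero -/

/-- The integer polynomial `A = Σ_{λ ∈ Λ_T} a_λ X₀^{λ₁} X₁^{λ₂}` evaluates at `(X, X·J(X))` to `F_a`.
[folklore] -/
theorem aeval_auxPoly (a : ℕ × ℕ → ℤ) (T : ℕ) :
    MvPolynomial.aeval ![(PowerSeries.X : PowerSeries ℤ), formalXJ]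
      (∑ l ∈ (range (2 * T ^ 6) ×ˢ range (T ^ 4)), MvPolynomial.C (a l) * MvPolynomial.X 0 ^ l.1 * MvPolynomial.X 1 ^ l.2 :
        MvPolynomial (Fin 2) ℤ) = (∑ l ∈ range (2 * T ^ 6) ×ˢ range (T ^ 4), PowerSeries.C (a l) * X ^ l.1 * formalXJ ^ l.2) := by
  rw [map_sum]
  refine sum_congr rfl fun l _ ↦ ?_
  simp only [map_mul, map_pow, MvPolynomial.aeval_X, Matrix.cons_val_zero, Matrix.cons_val_one,
    eq_intCast, map_intCast]

/-- Base change of `F_a` to `ℂ`: `F_a ⊗ ℂ = A_ℂ(X, X·J(X))` with `A_ℂ` the image of `A` in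
`ℂ[X₀, X₁]`. [folklore] -/
theorem map_auxSeries_eq_aeval (a : ℕ × ℕ → ℤ) (T : ℕ) :
    PowerSeries.map (Int.castRingHom ℂ) (∑ l ∈ range (2 * T ^ 6) ×ˢ range (T ^ 4), PowerSeries.C (a l) * X ^ l.1 * formalXJ ^ l.2) =
      MvPolynomial.aeval ![(PowerSeries.X : PowerSeries ℂ), PowerSeries.map (Int.castRingHom ℂ) formalXJ]
        (∑ l ∈ (range (2 * T ^ 6) ×ˢ range (T ^ 4)), MvPolynomial.C (a l : ℂ) * MvPolynomial.X 0 ^ l.1 * MvPolynomial.X 1 ^ l.2 :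
          MvPolynomial (Fin 2) ℂ) := by
  rw [map_sum, map_sum]
  refine sum_congr rfl fun l _ ↦ ?_
  simp only [map_mul, map_pow, PowerSeries.map_X, MvPolynomial.aeval_X, Matrix.cons_val_zero,
    Matrix.cons_val_one, eq_intCast, map_intCast]

/-- The complex polynomial `A_ℂ = Σ_{λ ∈ Λ_T} a_λ X₀^{λ₁} X₁^{λ₂}` is nonzero as soon as some
`a_λ ≠ 0`, `λ ∈ Λ_T` (distinct exponent pairs give distinct monomials). [folklore] -/
theorem auxPolyC_ne_zero {a : ℕ × ℕ → ℤ} {T : ℕ} {l₀ : ℕ × ℕ} (hl₀ : l₀ ∈ (range (2 * T ^ 6) ×ˢ range (T ^ 4))) (ha : a l₀ ≠ 0) :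
    (∑ l ∈ (range (2 * T ^ 6) ×ˢ range (T ^ 4)), MvPolynomial.C (a l : ℂ) * MvPolynomial.X 0 ^ l.1 * MvPolynomial.X 1 ^ l.2 :
      MvPolynomial (Fin 2) ℂ) ≠ 0 := by
  classical
  -- exponent vectors
  set s : ℕ × ℕ → (Fin 2 →₀ ℕ) := fun l ↦ Finsupp.single 0 l.1 + Finsupp.single 1 l.2 with hs
  have hs_inj : Function.Injective s := by
    intro l l' h
    have h0 := congr_arg (fun f : Fin 2 →₀ ℕ ↦ f 0) h
    have h1 := congr_arg (fun f : Fin 2 →₀ ℕ ↦ f 1) h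
    simp only [hs, Finsupp.coe_add, Pi.add_apply, Finsupp.single_eq_same, ne_eq, zero_ne_one,
      not_false_eq_true, Finsupp.single_eq_of_ne, add_zero, one_ne_zero, zero_add] at h0 h1
    exact Prod.ext h0 h1
  have hmono : ∀ l : ℕ × ℕ, (MvPolynomial.C (a l : ℂ) * MvPolynomial.X 0 ^ l.1 * MvPolynomial.X 1 ^ l.2 :
      MvPolynomial (Fin 2) ℂ) = MvPolynomial.monomial (s l) (a l : ℂ) := by
    intro l
    rw [MvPolynomial.X_pow_eq_monomial, MvPolynomial.X_pow_eq_monomial, MvPolynomial.C_mul_monomial,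
      MvPolynomial.monomial_mul]
    simp [hs]
  intro h
  have hcoeff := congr_arg (MvPolynomial.coeff (s l₀)) h
  rw [MvPolynomial.coeff_sum, MvPolynomial.coeff_zero, sum_eq_single l₀] at hcoeff
  · rw [hmono, MvPolynomial.coeff_monomial, if_pos rfl] at hcoeff
    exact ha (by exact_mod_cast hcoeff)
  · intro l _ hl
    rw [hmono, MvPolynomial.coeff_monomial, if_neg (fun h' ↦ hl (hs_inj h'))]
  · intro h'
    exact absurd hl₀ h'

/-- **`F_a ≠ 0` for `a ≠ 0`** (supported in `Λ_T`): the power series `X^{λ₁}(X J(X))^{λ₂}` are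
linearly independent over `ℤ`, by the algebraic independence of `X` and `X·J(X)` over `ℂ`
(`FormalXJTranscendental_holds`, BDGP Lemme 4 / Nesterenko–Philippon Ch. 2 Lemma 2.7).
[cite: NesterenkoPhilippon2001, Ch. 2, Lemma 2.7] -/
theorem auxSeries_ne_zero {a : ℕ × ℕ → ℤ} {T : ℕ} (hsupp : ∀ l, l ∉ (range (2 * T ^ 6) ×ˢ range (T ^ 4)) → a l = 0) (ha : a ≠ 0) :
    (∑ l ∈ range (2 * T ^ 6) ×ˢ range (T ^ 4), PowerSeries.C (a l) * X ^ l.1 * formalXJ ^ l.2) ≠ 0 := by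
  obtain ⟨l₀, hl₀⟩ := Function.ne_iff.mp ha
  have hmem : l₀ ∈ (range (2 * T ^ 6) ×ˢ range (T ^ 4)) := by
    by_contra h
    exact hl₀ (hsupp l₀ h)
  intro h0
  have h1 := congr_arg (PowerSeries.map (Int.castRingHom ℂ)) h0
  rw [map_zero, map_auxSeries_eq_aeval] at h1
  exact auxPolyC_ne_zero hmem hl₀
    (AlgebraicIndependent.eq_zero_of_aeval_eq_zero FormalXJTranscendental_holds _ h1)

/-! ### The order of vanishing -/

/-- A nonzero power series whose first `N` coefficients vanish has an order of vanishing
`M ≥ N` with `coeff_M ≠ 0`. [folklore] -/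
theorem exists_order_of_ne_zero {φ : PowerSeries ℤ} (hφ : φ ≠ 0) {N : ℕ}
    (hN : ∀ n < N, coeff n φ = 0) :
    ∃ M : ℕ, N ≤ M ∧ coeff M φ ≠ 0 ∧ ∀ n < M, coeff n φ = 0 := by
  refine ⟨φ.order.toNat, ?_, coeff_order hφ, fun n hn ↦ coeff_of_lt_order_toNat n hn⟩
  have h1 : (N : ℕ∞) ≤ φ.order := nat_le_order φ N hN
  have h2 : φ.order ≠ ⊤ := fun h ↦ hφ (order_eq_top.mp h)
  have := ENat.coe_toNat h2
  rw [← this] at h1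
  exact_mod_cast h1

/-- **Summary of the first step.**  For `T ≥ 1` there are integers `a_λ` supported in `Λ_T`,
not all zero, with `Σ |a_λ| ≤ 4T²⁰ exp(56T⁷ + 27T⁴)`, and an integer `M ≥ T¹⁰` such that the
coefficients `bₙ` of `F_a = Σ a_λ X^{λ₁}(XJ)^{λ₂}` vanish for `n < M`, `b_M ≠ 0`, and
`|bₙ| ≤ (Σ|a_λ|) exp(56T²√n + 27T⁴)` for all `n`. [cite: NesterenkoPhilippon2001, Ch. 2, §2.5] -/
theorem exists_auxiliary (T : ℕ) (hT : 1 ≤ T) :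
    ∃ (a : ℕ × ℕ → ℤ) (M : ℕ), (∀ l, l ∉ (range (2 * T ^ 6) ×ˢ range (T ^ 4)) → a l = 0) ∧ a ≠ 0 ∧
      (∑ l ∈ (range (2 * T ^ 6) ×ˢ range (T ^ 4)), |(a l : ℝ)|) ≤ 4 * T ^ 20 * Real.exp (56 * T ^ 7 + 27 * T ^ 4) ∧
      T ^ 10 ≤ M ∧ coeff M (∑ l ∈ range (2 * T ^ 6) ×ˢ range (T ^ 4), PowerSeries.C (a l) * X ^ l.1 * formalXJ ^ l.2) ≠ 0 ∧ (∀ n < M, coeff n (∑ l ∈ range (2 * T ^ 6) ×ˢ range (T ^ 4), PowerSeries.C (a l) * X ^ l.1 * formalXJ ^ l.2) = 0) ∧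
      ∀ n, |((coeff n (∑ l ∈ range (2 * T ^ 6) ×ˢ range (T ^ 4), PowerSeries.C (a l) * X ^ l.1 * formalXJ ^ l.2) : ℤ) : ℝ)| ≤
        (∑ l ∈ (range (2 * T ^ 6) ×ˢ range (T ^ 4)), |(a l : ℝ)|) * Real.exp (56 * T ^ 2 * Real.sqrt n + 27 * T ^ 4) := by
  obtain ⟨a, hsupp, ha, hbound, hsys⟩ := exists_siegel_coeffs T hT
  obtain ⟨M, hNM, hM, hlt⟩ := exists_order_of_ne_zero (auxSeries_ne_zero hsupp ha) hsys
  refine ⟨a, M, hsupp, ha, ?_, hNM, hM, hlt, abs_coeff_auxSeries_le a T⟩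
  calc ∑ l ∈ (range (2 * T ^ 6) ×ˢ range (T ^ 4)), |(a l : ℝ)| ≤ ∑ l ∈ (range (2 * T ^ 6) ×ˢ range (T ^ 4)), 2 * T ^ 10 * Real.exp (56 * T ^ 7 + 27 * T ^ 4) :=
        sum_le_sum fun l _ ↦ hbound l
    _ = 4 * T ^ 20 * Real.exp (56 * T ^ 7 + 27 * T ^ 4) := by
        rw [sum_const, card_product, card_range, card_range, nsmul_eq_mul]
        push_cast
        ring

end Literature.NumberTheory.Transcendental

end
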